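import Mathlib.Topology.Instances.AddCircle.Real
import Literature.NumberTheory.EllipticCurves.NeronLocalHeightBadPlaces
import Literature.NumberTheory.EllipticCurves.NeronLocalHeightIdentityComponent
import Literature.NumberTheory.EllipticCurves.TateNormalFormComponentsSum
import Literature.NumberTheory.EllipticCurves.SplitMultiplicativeNormalForm
import HarnessLib

/-!
# Tate's `λ` on the Tate normal form `y² + xy = x³ + απⁿ`: the `B₂`-formula (ATAEC VI.4.2 / Ex. 6.7)

Topic `NumberTheory/EllipticCurves` (family `abc`, G06). Pure proofs, no definitions and no named
facts. For the Tate normal form `J : y² + xy = x³ + απⁿ` (`α ∈ Rˣ`, `π` a uniformiser, `n ≥ 1`)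
over a discrete valuation ring `R` with fraction field `K`, a nonarchimedean real absolute value
`|·|` on `K` with unit ball `R`, and a homomorphism `c : J(K) →+ ℤ/nℤ` with kernel `J₀(K)`
labelling the shapes of bad points as in `TateNormalFormComponents.lean`
(`LocalIndex.exists_addMonoidHom_zmod_of_tateNormalForm`), we evaluate **Tate's series**
`λ = λ₁ + Σ 4^{-(k+1)} f(2ᵏP)` (`WeierstrassCurve.Affine.Point.neronLocalHeight`, ATAEC
Thm. VI.1.1) in closed form:

`λ(P) = ½ log⁺|x(P)| + ½ 𝐁₂(c(P)/n) · n · v(π)`  (`v = −log|·|`, `𝐁₂` the periodic second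
Bernoulli function, `n v(π) = v(Δ)`; `neronLocalHeight_eq_of_tateNormalForm`),

which is Silverman, *ATAEC*, Thm. VI.4.2(b) (`λ(φ(u)) = ½B₂(v(u)/v(q))v(q)` for
`0 < v(u) < v(q)`, via Tate's parametrisation) and Ex. 6.7(b) (`λ(P) = ½B₂(α(P))v(Δ)`,
`α(P) = min{v(2y + x)/v(Δ), ½}` for `P ∉ E₀(K)`), together with Thm. VI.4.1 on `E₀(K)`; here
for Tate's series and without `q`-expansions. In particular `λ(P) ≥ ½ 𝐁₂(c(P)/n) · v(Δ)`
(`le_neronLocalHeight_of_tateNormalForm`), the local inequality at a split multiplicative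
place behind `Literature.NumberTheory.EllipticCurves.exists_bernoulli_le_neronLocalHeight_of_hasSplitMultiplicativeReductionAt`.

## Proof

Tate's correction term is constant on each component: `f(P) = (n/4 − ℓ(P)) v(π)` where
`ℓ(P) = min(c(P), n − c(P)) ∈ {0, …, ⌊n/2⌋}` is the *level* (`tateCorrection_eq_of_level`): on
`J₀(K)` this is ATAEC VI.4.1 (`tateCorrection_eq_of_hasNonsingularReduction`), and on a bad
point of level `ℓ` one has `ψ₂²(x) = x²(4x + 1) + 4a₆`, `φ₂(x) = x⁴ − a₆(8x + 1)` with
`min{v(φ₂), v(ψ₂²)} = 2ℓ v(π)` (`max_abv_duplication_eq_of_level`). Since `c(2ᵏP) = 2ᵏc(P)`,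
Tate's series becomes `μ(P) = (n/12)v(π) − v(π) Σ 4^{-(k+1)} ℓ(2ᵏc(P))`, and the elementary
identity `Σ_{k ≥ 0} 4^{-(k+1)} min(2ᵏa mod n, n − 2ᵏa mod n) = a(n − a)/(2n)`
(`tsum_level_two_pow_nsmul`: both sides are the bounded solution of `F(a) = ¼ℓ(a) + ¼F(2a)` on
`ℤ/nℤ`) gives `μ(P) = ½B₂(a/n)·n v(π)` for `c(P) = a mod n`, `0 ≤ a < n`.

## References

* J. H. Silverman, *Advanced Topics in the Arithmetic of Elliptic Curves*, GTM 151 (1994),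
  Thm. VI.1.1 (PDF pp. 419–422), Thm. VI.4.1 (PDF p. 428), Thm. VI.4.2 (PDF p. 430),
  Ex. 6.7 (PDF p. 434), Cor. IV.9.2(d) (PDF p. 340).
-/

noncomputable section

open scoped Classical

open IsLocalRing Polynomial

namespace Literature.NumberTheory.EllipticCurves

namespace LocalIndex

/-! ### The level series on `ℤ/nℤ` -/

section LevelSeries

variable {n : ℕ} [NeZero n]

/-- The functional equation of `B(a) = a(n − a)/(2n)` on `ℤ/nℤ`:
`B(a) = ¼ min(a, n − a) + ¼ B(2a)`. [folklore] -/
theorem level_rel_two_nsmul (m : ZMod n) :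
    (m.val : ℝ) * ((n : ℝ) - m.val) / (2 * n) =
      1 / 4 * ((min m.val (n - m.val) : ℕ) : ℝ) +
        1 / 4 * (((2 • m).val : ℝ) * ((n : ℝ) - (2 • m).val) / (2 * n)) := by
  have hn : (0 : ℝ) < n := by exact_mod_cast Nat.pos_of_ne_zero (NeZero.ne n)
  have ha : m.val < n := ZMod.val_lt m
  have h2 : (2 • m).val = (m.val + m.val) % n := by rw [two_nsmul, ZMod.val_add]
  by_cases hlt : 2 * m.val < n
  · have h2' : (2 • m).val = 2 * m.val := by
      rw [h2, Nat.mod_eq_of_lt (by omega)]; ring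
    have hmin : min m.val (n - m.val) = m.val := min_eq_left (by omega)
    rw [h2', hmin]
    push_cast
    field_simp
    ring
  · have h2' : (2 • m).val = 2 * m.val - n := by
      rw [h2, show m.val + m.val = 2 * m.val by ring, Nat.mod_eq_sub_mod (by omega),
        Nat.mod_eq_of_lt (by omega)]
    have hmin : min m.val (n - m.val) = n - m.val := min_eq_right (by omega)
    rw [h2', hmin, Nat.cast_sub (by omega), Nat.cast_sub (by omega)]
    push_cast
    field_simp
    ring

/-- `2^(k+1) a = 2^k (2a)`. [folklore] -/
theorem two_pow_succ_nsmul {M : Type*} [AddCommMonoid M] (k : ℕ) (m : M) :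
    2 ^ (k + 1) • m = 2 ^ k • (2 • m) := by
  rw [pow_succ, mul_comm, mul_nsmul]

/-- **The level series**: for `a ∈ ℤ/nℤ`,
`Σ_{k ≥ 0} 4^{-(k+1)} min(2ᵏa mod n, n − (2ᵏa mod n)) = a(n − a)/(2n)` (`0 ≤ a < n` the
representative). Both sides are bounded solutions `F` of `F(a) = ¼ min(a, n − a) + ¼ F(2a)` on
the finite set `ℤ/nℤ`, and such a solution is unique (`F − F'` satisfies `G(a) = 4⁻ᵏG(2ᵏa) → 0`).
This is the identity `Σ 4^{-(k+1)} ‖2ᵏt‖ = ½{t}(1 − {t}) = 1/12 − ½𝐁₂(t)` behind the closed form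
of Tate's series on a Tate curve. [folklore] -/
theorem tsum_level_two_pow_nsmul (m : ZMod n) :
    ∑' k : ℕ, (1 / 4 : ℝ) ^ (k + 1) * ((min (2 ^ k • m).val (n - (2 ^ k • m).val) : ℕ) : ℝ) =
      (m.val : ℝ) * ((n : ℝ) - m.val) / (2 * n) := by
  -- the level function and its series
  set ℓ : ZMod n → ℝ := fun m => ((min m.val (n - m.val) : ℕ) : ℝ) with hℓ
  have hℓ0 : ∀ m, 0 ≤ ℓ m := fun m => Nat.cast_nonneg _
  have hℓn : ∀ m, ℓ m ≤ n := fun m => by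
    show ((min m.val (n - m.val) : ℕ) : ℝ) ≤ n
    exact_mod_cast (min_le_left _ _).trans (ZMod.val_lt m).le
  have hgeom : Summable fun k : ℕ => (1 / 4 : ℝ) ^ (k + 1) * n :=
    ((summable_geometric_of_lt_one (by norm_num) (by norm_num : (1 / 4 : ℝ) < 1)).mul_left
      (1 / 4 * (n : ℝ))).congr fun k => by ring
  have hsum : ∀ m, Summable fun k : ℕ => (1 / 4 : ℝ) ^ (k + 1) * ℓ (2 ^ k • m) := by
    intro m
    exact Summable.of_nonneg_of_le (fun k => mul_nonneg (by positivity) (hℓ0 _))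
      (fun k => mul_le_mul_of_nonneg_left (hℓn _) (by positivity)) hgeom
  set F : ZMod n → ℝ := fun m => ∑' k : ℕ, (1 / 4 : ℝ) ^ (k + 1) * ℓ (2 ^ k • m) with hF
  -- `F(a) = ¼ ℓ(a) + ¼ F(2a)`
  have hFrel : ∀ m, F m = 1 / 4 * ℓ m + 1 / 4 * F (2 • m) := by
    intro m
    rw [hF]
    dsimp only
    rw [(hsum m).tsum_eq_zero_add, pow_zero, one_nsmul, zero_add, pow_one, ← tsum_mul_left]
    congr 1
    refine tsum_congr fun k => ?_
    rw [two_pow_succ_nsmul, pow_succ]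
    ring
  -- `B(a) = a(n-a)/(2n)` satisfies the same relation
  set B : ZMod n → ℝ := fun m => (m.val : ℝ) * ((n : ℝ) - m.val) / (2 * n) with hB
  have hBrel : ∀ m, B m = 1 / 4 * ℓ m + 1 / 4 * B (2 • m) := fun m => level_rel_two_nsmul m
  -- the difference `G` satisfies `G(a) = 4⁻ᵏ G(2ᵏ a)`
  set G : ZMod n → ℝ := fun m => F m - B m with hG
  have hGrel : ∀ (k : ℕ) (m : ZMod n), G m = (1 / 4 : ℝ) ^ k * G (2 ^ k • m) := by
    intro k
    induction k with
    | zero => intro m; simp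
    | succ k ih =>
      intro m
      have h1 : G m = 1 / 4 * G (2 • m) := by
        rw [hG]; dsimp only; rw [hFrel m, hBrel m]; ring
      rw [h1, ih (2 • m), ← two_pow_succ_nsmul, pow_succ]
      ring
  -- `G` is bounded on the finite set `ℤ/nℤ`, hence zero
  set M : ℝ := ∑ m : ZMod n, |G m| with hM
  have hGM : ∀ m, |G m| ≤ M := fun m =>
    Finset.single_le_sum (f := fun m => |G m|) (fun m _ => abs_nonneg _) (Finset.mem_univ m)
  have hM0 : 0 ≤ M := Finset.sum_nonneg fun m _ => abs_nonneg _
  have hG0 : G m = 0 := by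
    by_contra hne
    have hpos : 0 < |G m| := abs_pos.mpr hne
    have hbound : ∀ k : ℕ, |G m| ≤ (1 / 4 : ℝ) ^ k * M := fun k => by
      rw [hGrel k m, abs_mul, abs_of_nonneg (by positivity)]
      exact mul_le_mul_of_nonneg_left (hGM _) (by positivity)
    rcases eq_or_lt_of_le hM0 with hM0' | hMpos
    · have := hbound 0
      rw [← hM0', mul_zero] at this
      exact absurd this (not_le.mpr hpos)
    · obtain ⟨k, hk⟩ := exists_pow_lt_of_lt_one (div_pos hpos hMpos) (by norm_num : (1 / 4 : ℝ) < 1)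
      have := hbound k
      rw [lt_div_iff₀ hMpos] at hk
      linarith
  have : F m = B m := by
    have h := hG0
    rw [hG] at h
    dsimp only at h
    linarith
  rw [hF, hB] at this
  exact this

end LevelSeries

/-! ### The `2`-division quantities of the Tate normal form -/

section TateNormalForm

open DiophantineGeometry DiophantineGeometry.TateAlgorithm _root_.WeierstrassCurve.Affine.Point

variable {R : Type*} [CommRing R] [IsDomain R] [IsDiscreteValuationRing R]
  {K : Type*} [Field K] [Algebra R K] [IsFractionRing R K]
  (J : WeierstrassCurve R) {ϖ α : R} {n : ℕ} {abv : AbsoluteValue K ℝ}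

omit [IsDomain R] [IsDiscreteValuationRing R] in
/-- `ψ₂²(x) = 4x³ + b₂x² + 2b₄x + b₆ = x²(4x + 1) + 4a₆` on `y² + xy = x³ + a₆`
(`b₂ = 1`, `b₄ = 0`, `b₆ = 4a₆`). [folklore] -/
theorem eval_Ψ₂Sq_of_tateNormalForm (h1 : J.a₁ = 1) (h2 : J.a₂ = 0) (h3 : J.a₃ = 0)
    (h4 : J.a₄ = 0) (x : R) : J.Ψ₂Sq.eval x = x ^ 2 * (4 * x + 1) + 4 * J.a₆ := by
  rw [eval_Ψ₂Sq]
  simp only [WeierstrassCurve.b₂, WeierstrassCurve.b₄, WeierstrassCurve.b₆, h1, h2, h3, h4]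
  ring

omit [IsDomain R] [IsDiscreteValuationRing R] in
/-- `φ₂(x) = x⁴ − b₄x² − 2b₆x − b₈ = x⁴ − a₆(8x + 1)` on `y² + xy = x³ + a₆`
(`b₄ = 0`, `b₆ = 4a₆`, `b₈ = a₆`). [folklore] -/
theorem eval_Φ_two_of_tateNormalForm (h1 : J.a₁ = 1) (h2 : J.a₂ = 0) (h3 : J.a₃ = 0)
    (h4 : J.a₄ = 0) (x : R) : (J.Φ 2).eval x = x ^ 4 - J.a₆ * (8 * x + 1) := by
  rw [eval_Φ_two]
  simp only [WeierstrassCurve.b₄, WeierstrassCurve.b₆, WeierstrassCurve.b₈, h1, h2, h3, h4]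
  ring

/-! ### An absolute value with unit ball `R` -/

section AbsValue

variable (hna : IsNonarchimedean abv)
  (habv : ∀ x : K, abv x ≤ 1 ↔ ValuationRing.valuation R K x ≤ 1)
include habv

/-- Elements of `R` have absolute value `≤ 1`. [folklore] -/
theorem abv_algebraMap_le_one (r : R) : abv (algebraMap R K r) ≤ 1 :=
  (habv _).mpr ((integers_valuationRing_valuation R K).map_le_one r)

/-- Elements of `𝔪` have absolute value `< 1`. [folklore] -/
theorem abv_algebraMap_lt_one {r : R} (hr : r ∈ maximalIdeal R) : abv (algebraMap R K r) < 1 :=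
  (abv_lt_one_iff_of_le_one_iff habv _).mpr
    ((v_algebraMap_lt_one_iff (integers_valuationRing_valuation R K) r).mpr
      ((residue_eq_zero_iff _).mpr hr))

/-- Units of `R` have absolute value `1`. [folklore] -/
theorem abv_algebraMap_eq_one {r : R} (hr : IsUnit r) : abv (algebraMap R K r) = 1 :=
  (abv_eq_one_iff_of_le_one_iff habv _).mpr
    ((v_algebraMap_eq_one_iff (integers_valuationRing_valuation R K) r).mpr
      ((isUnit_iff_residue_ne_zero r).mp hr))

/-- `|πᵏ u| = |π|ᵏ` for a unit `u`. [folklore] -/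
theorem abv_algebraMap_pow_mul_unit {u : R} (hu : IsUnit u) (k : ℕ) :
    abv (algebraMap R K (ϖ ^ k * u)) = abv (algebraMap R K ϖ) ^ k := by
  rw [map_mul, map_pow, abv.map_mul, abv.map_pow, abv_algebraMap_eq_one habv hu, mul_one]

/-- **The discriminant**: `|Δ| = |π|ⁿ` for `y² + xy = x³ + απⁿ` (`Δ = −απⁿ(1 + 432απⁿ)`), i.e.
`v(Δ) = n v(π)`. [folklore] -/
theorem abv_Δ_of_tateNormalForm (hϖ : Irreducible ϖ) (h1 : J.a₁ = 1) (h2 : J.a₂ = 0)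
    (h3 : J.a₃ = 0) (h4 : J.a₄ = 0) (hα : IsUnit α) (hn : 1 ≤ n) (h6 : J.a₆ = α * ϖ ^ n) :
    abv (J.baseChange K).Δ = abv (algebraMap R K ϖ) ^ n := by
  have hm' : ϖ ∈ maximalIdeal R := (IsLocalRing.mem_maximalIdeal _).mpr hϖ.not_isUnit
  have hΔ : (J.baseChange K).Δ = algebraMap R K J.Δ := J.map_Δ _
  have hu : IsUnit (-(α * (1 + 432 * J.a₆))) := by
    rw [IsUnit.neg_iff]
    refine hα.mul (isUnit_add_of_isUnit_of_mem isUnit_one (Ideal.mul_mem_left _ _ ?_))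
    rw [h6]
    exact Ideal.mul_mem_left _ _ (Ideal.pow_mem_of_mem _ hm' n hn)
  rw [hΔ, J.Δ_eq_of_tateNormalForm h1 h2 h3 h4,
    show -(J.a₆ * (1 + 432 * J.a₆)) = ϖ ^ n * -(α * (1 + 432 * J.a₆)) by rw [h6]; ring,
    abv_algebraMap_pow_mul_unit habv hu]

/-- `0 < |π| < 1`, so `v(π) = −log|π| > 0`. [folklore] -/
theorem abv_uniformizer_pos_lt_one (hϖ : Irreducible ϖ) :
    0 < abv (algebraMap R K ϖ) ∧ abv (algebraMap R K ϖ) < 1 :=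
  ⟨abv.pos ((map_ne_zero_iff _ (IsFractionRing.injective R K)).mpr hϖ.ne_zero),
    abv_algebraMap_lt_one habv ((IsLocalRing.mem_maximalIdeal _).mpr hϖ.not_isUnit)⟩

/-- **Tate's correction term at a bad point of level `ℓ`.** On `J : y² + xy = x³ + απⁿ`, let
`(x, y)` be an `R`-point such that `ψ₂²(x) = π^{2ℓ}ψ₀`, `φ₂(x) = π^{2ℓ}φ₀` with `ψ₀, φ₀ ∈ R`,
one of them a unit. Then `max{|φ₂(x)|, |ψ₂²(x)|} = |π|^{2ℓ}` and `max{|x|⁴, 1} = 1`, so Tate's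
`f = ½ log(max{|φ₂|, |ψ₂²|}/max{|x|⁴, 1}) − ¼ log|Δ|` equals `(n/4 − ℓ)·v(π)` (`|Δ| = |π|ⁿ`).
[cite: Silverman1994, Ex. 6.7(b)] -/
theorem tateCorrection_some_of_level (hϖ : Irreducible ϖ) (h1 : J.a₁ = 1) (h2 : J.a₂ = 0)
    (h3 : J.a₃ = 0) (h4 : J.a₄ = 0) (hα : IsUnit α) (hn : 1 ≤ n) (h6 : J.a₆ = α * ϖ ^ n)
    {x y ψ₀ φ₀ : R} {ℓ : ℕ}
    (hψ : J.Ψ₂Sq.eval x = ϖ ^ (2 * ℓ) * ψ₀) (hφ : (J.Φ 2).eval x = ϖ ^ (2 * ℓ) * φ₀)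
    (hu : IsUnit ψ₀ ∨ IsUnit φ₀)
    (h : (J.baseChange K).toAffine.Nonsingular (algebraMap R K x) (algebraMap R K y)) :
    tateCorrection abv (.some _ _ h) =
      ((n : ℝ) / 4 - ℓ) * (-Real.log (abv (algebraMap R K ϖ))) := by
  set f := algebraMap R K with hf
  have hm' : ϖ ∈ maximalIdeal R := (IsLocalRing.mem_maximalIdeal _).mpr hϖ.not_isUnit
  obtain ⟨hϖpos, hϖlt⟩ := abv_uniformizer_pos_lt_one (abv := abv) habv hϖ
  have hΦ : ((J.baseChange K).Φ 2).eval (f x) = f ((J.Φ 2).eval x) := by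
    rw [WeierstrassCurve.baseChange, WeierstrassCurve.map_Φ, Polynomial.eval_map_apply]
  have hΨ : (J.baseChange K).Ψ₂Sq.eval (f x) = f (J.Ψ₂Sq.eval x) := by
    rw [WeierstrassCurve.baseChange, WeierstrassCurve.map_Ψ₂Sq, Polynomial.eval_map_apply]
  -- `max{|φ₂|, |ψ₂²|} = |ϖ|^{2ℓ}`
  have hmax : max (abv (((J.baseChange K).Φ 2).eval (f x))) (abv ((J.baseChange K).Ψ₂Sq.eval (f x))) =
      abv (f ϖ) ^ (2 * ℓ) := by
    rw [hΦ, hΨ, hφ, hψ]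
    simp only [map_mul, map_pow]
    rw [← mul_max_of_nonneg _ _ (pow_nonneg (abv.nonneg _) _)]
    have h1' : max (abv (f φ₀)) (abv (f ψ₀)) = 1 := by
      refine le_antisymm (max_le (abv_algebraMap_le_one habv _) (abv_algebraMap_le_one habv _)) ?_
      rcases hu with hu | hu
      · exact le_max_of_le_right (abv_algebraMap_eq_one habv hu).ge
      · exact le_max_of_le_left (abv_algebraMap_eq_one habv hu).ge
    rw [h1', mul_one]
  -- `max{|x|⁴, 1} = 1`
  have hx1 : max (abv (f x) ^ 4) 1 = 1 :=
    max_eq_right (pow_le_one₀ (abv.nonneg _) (abv_algebraMap_le_one habv _))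
  rw [tateCorrection_some, hmax, hx1, div_one, abv_Δ_of_tateNormalForm J habv hϖ h1 h2 h3 h4 hα hn h6,
    Real.log_pow, Real.log_pow]
  push_cast
  ring

/-- **Low points have level `i`**: for `(x, y) = (πⁱu, ·)` with `u ∈ Rˣ`, `1 ≤ i`, `2i < n`,
`ψ₂²(x) = π^{2i}(u²(4x + 1) + 4απ^{n−2i})` has a unit cofactor, and `φ₂(x) = π^{2i}(π^{2i}u⁴ −
απ^{n−2i}(8x + 1))`; so `f(x, y) = (n/4 − i) v(π)`. [cite: Silverman1994, Ex. 6.7(b)] -/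
theorem tateCorrection_some_of_low (hϖ : Irreducible ϖ) (h1 : J.a₁ = 1) (h2 : J.a₂ = 0)
    (h3 : J.a₃ = 0) (h4 : J.a₄ = 0) (hα : IsUnit α) (hn : 1 ≤ n) (h6 : J.a₆ = α * ϖ ^ n)
    {i : ℕ} {u y : R} (hi : 1 ≤ i) (h2i : 2 * i < n) (hu : IsUnit u)
    (h : (J.baseChange K).toAffine.Nonsingular (algebraMap R K (ϖ ^ i * u)) (algebraMap R K y)) :
    tateCorrection abv (.some _ _ h) =
      ((n : ℝ) / 4 - i) * (-Real.log (abv (algebraMap R K ϖ))) := by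
  have hm' : ϖ ∈ maximalIdeal R := (IsLocalRing.mem_maximalIdeal _).mpr hϖ.not_isUnit
  obtain ⟨d, hd⟩ : ∃ d, n = 2 * i + (d + 1) := ⟨n - 2 * i - 1, by omega⟩
  have h4x : IsUnit (4 * (ϖ ^ i * u) + 1) := by
    rw [add_comm]
    refine isUnit_add_of_isUnit_of_mem isUnit_one (Ideal.mul_mem_left _ _ ?_)
    exact Ideal.mul_mem_right _ _ (Ideal.pow_mem_of_mem _ hm' i hi)
  refine tateCorrection_some_of_level J habv hϖ h1 h2 h3 h4 hα hn h6
    (ψ₀ := u ^ 2 * (4 * (ϖ ^ i * u) + 1) + 4 * α * ϖ ^ (d + 1))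
    (φ₀ := ϖ ^ (2 * i) * u ^ 4 - α * ϖ ^ (d + 1) * (8 * (ϖ ^ i * u) + 1)) ?_ ?_ (Or.inl ?_) h
  · rw [eval_Ψ₂Sq_of_tateNormalForm J h1 h2 h3 h4, h6, hd]; ring
  · rw [eval_Φ_two_of_tateNormalForm J h1 h2 h3 h4, h6, hd]; ring
  · refine isUnit_add_of_isUnit_of_mem ((hu.pow 2).mul h4x) ?_
    rw [pow_succ]
    exact Ideal.mul_mem_left _ _ (Ideal.mul_mem_left _ _ hm')

/-- **Middle points have level `h = n/2`**: for `(x, y) = (πʰx', ·)`, `n = 2h`,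
`φ₂(x) = π^{2h}(π^{2h}x'⁴ − α(8x + 1))` has a unit cofactor and
`ψ₂²(x) = π^{2h}(x'²(4x + 1) + 4α)`; so `f(x, y) = (n/4 − h) v(π) = −(n/4) v(π)`.
[cite: Silverman1994, Ex. 6.7(b)] -/
theorem tateCorrection_some_of_middle (hϖ : Irreducible ϖ) (h1 : J.a₁ = 1) (h2 : J.a₂ = 0)
    (h3 : J.a₃ = 0) (h4 : J.a₄ = 0) (hα : IsUnit α) (hn : 1 ≤ n) (h6 : J.a₆ = α * ϖ ^ n)
    {hh : ℕ} {x' y : R} (hnh : n = 2 * hh)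
    (h : (J.baseChange K).toAffine.Nonsingular (algebraMap R K (ϖ ^ hh * x')) (algebraMap R K y)) :
    tateCorrection abv (.some _ _ h) =
      ((n : ℝ) / 4 - hh) * (-Real.log (abv (algebraMap R K ϖ))) := by
  have hm' : ϖ ∈ maximalIdeal R := (IsLocalRing.mem_maximalIdeal _).mpr hϖ.not_isUnit
  have hh1 : 1 ≤ hh := by omega
  have h8x : IsUnit (8 * (ϖ ^ hh * x') + 1) := by
    rw [add_comm]
    refine isUnit_add_of_isUnit_of_mem isUnit_one (Ideal.mul_mem_left _ _ ?_)
    exact Ideal.mul_mem_right _ _ (Ideal.pow_mem_of_mem _ hm' hh hh1)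
  refine tateCorrection_some_of_level J habv hϖ h1 h2 h3 h4 hα hn h6
    (ψ₀ := x' ^ 2 * (4 * (ϖ ^ hh * x') + 1) + 4 * α)
    (φ₀ := ϖ ^ (2 * hh) * x' ^ 4 - α * (8 * (ϖ ^ hh * x') + 1)) ?_ ?_ (Or.inr ?_) h
  · rw [eval_Ψ₂Sq_of_tateNormalForm J h1 h2 h3 h4, h6, hnh]; ring
  · rw [eval_Φ_two_of_tateNormalForm J h1 h2 h3 h4, h6, hnh]; ring
  · rw [sub_eq_add_neg, add_comm]
    refine isUnit_add_of_isUnit_of_mem (hα.mul h8x).neg ?_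
    exact Ideal.mul_mem_right _ _ (Ideal.pow_mem_of_mem _ hm' _ (by omega))

/-! ### Tate's correction term and Tate's series through the component homomorphism -/

/-- **`f` is constant on components: `f(Q) = (n/4 − ℓ(Q)) v(π)`** for every `Q ∈ J(K)`, where
`ℓ(Q) = min(c(Q), n − c(Q))` is the level read off from a component homomorphism
`c : J(K) →+ ℤ/nℤ` with kernel `J₀(K)` and the shape values of
`LocalIndex.exists_addMonoidHom_zmod_of_tateNormalForm` (on `J₀(K)` this is ATAEC Thm. VI.4.1,
`tateCorrection_eq_of_hasNonsingularReduction`; on bad points `tateCorrection_some_of_low`,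
`tateCorrection_some_of_middle` via `LocalIndex.shape_of_bad`). [cite: Silverman1994, Ex. 6.7(b)] -/
theorem tateCorrection_eq_of_component (hϖ : Irreducible ϖ) (h1 : J.a₁ = 1) (h2 : J.a₂ = 0)
    (h3 : J.a₃ = 0) (h4 : J.a₄ = 0) (hα : IsUnit α) (hn : 1 ≤ n) (h6 : J.a₆ = α * ϖ ^ n)
    (hna : IsNonarchimedean abv) {c : (J.baseChange K).toAffine.Point →+ ZMod n}
    (hc0 : ∀ P, c P = 0 ↔ J.HasNonsingularReduction P)
    (hcl : ∀ (i : ℕ) (u t : R) (h : (J.baseChange K).toAffine.Nonsingular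
        (algebraMap R K (ϖ ^ i * u)) (algebraMap R K (ϖ ^ i * u * t))),
      1 ≤ i → 2 * i < n → IsUnit u → t ∈ maximalIdeal R → c (.some _ _ h) = (i : ZMod n))
    (hcl' : ∀ (i : ℕ) (u t : R) (h : (J.baseChange K).toAffine.Nonsingular
        (algebraMap R K (ϖ ^ i * u)) (algebraMap R K (ϖ ^ i * u * t))),
      1 ≤ i → 2 * i < n → IsUnit u → t + 1 ∈ maximalIdeal R → c (.some _ _ h) = -(i : ZMod n))
    (hcm : ∀ (hh : ℕ) (x' y' : R) (h : (J.baseChange K).toAffine.Nonsingular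
        (algebraMap R K (ϖ ^ hh * x')) (algebraMap R K (ϖ ^ hh * y'))),
      n = 2 * hh → c (.some _ _ h) = (hh : ZMod n))
    (Q : (J.baseChange K).toAffine.Point) :
    tateCorrection abv Q =
      ((n : ℝ) / 4 - ((min (c Q).val (n - (c Q).val) : ℕ) : ℝ)) *
        (-Real.log (abv (algebraMap R K ϖ))) := by
  haveI : NeZero n := ⟨by omega⟩
  have hinj := IsFractionRing.injective R K
  have hw := integers_valuationRing_valuation R K
  have hm' : ϖ ∈ maximalIdeal R := (IsLocalRing.mem_maximalIdeal _).mpr hϖ.not_isUnit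
  have h3m : J.a₃ ∈ maximalIdeal R := h3 ▸ Ideal.zero_mem _
  have h4m : J.a₄ ∈ maximalIdeal R := h4 ▸ Ideal.zero_mem _
  have h6m : J.a₆ ∈ maximalIdeal R :=
    h6 ▸ Ideal.mul_mem_left _ _ (Ideal.pow_mem_of_mem _ hm' n hn)
  -- the value at `O`
  have hzero : tateCorrection abv (0 : (J.baseChange K).toAffine.Point) =
      ((n : ℝ) / 4 - ((min (c 0).val (n - (c 0).val) : ℕ) : ℝ)) *
        (-Real.log (abv (algebraMap R K ϖ))) := by
    rw [tateCorrection_zero, abv_Δ_of_tateNormalForm J habv hϖ h1 h2 h3 h4 hα hn h6, Real.log_pow,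
      _root_.map_zero, ZMod.val_zero, Nat.zero_min]
    push_cast
    ring
  rcases Q with _ | ⟨X, Y, h⟩
  · exact hzero
  by_cases hgood : J.HasNonsingularReduction (.some X Y h)
  · rw [tateCorrection_eq_of_hasNonsingularReduction hw hna habv hgood, hzero, (hc0 _).mpr hgood,
      _root_.map_zero]
  obtain ⟨x, y, h', hQ, hx, -⟩ := exists_eq_some_of_not_hasNonsingularReduction J h3m h4m h6m hgood
  rw [hQ]
  have he : J.toAffine.Equation x y :=
    (WeierstrassCurve.Affine.map_equation _ hinj x y).mp h'.left
  rcases shape_of_bad J hϖ h1 h2 h3 h4 hα h6 hx he with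
    ⟨i, u, t, hi, h2i, hu, rfl, rfl, ht⟩ | ⟨hh, x', y', hnh, -, rfl, rfl⟩
  · rw [tateCorrection_some_of_low J habv hϖ h1 h2 h3 h4 hα hn h6 hi h2i hu h']
    rcases ht with ht | ht
    · rw [hcl i u t h' hi h2i hu ht, ZMod.val_cast_of_lt (by omega), min_eq_left (by omega)]
    · rw [hcl' i u t h' hi h2i hu ht, ZMod.neg_val, if_neg, ZMod.val_cast_of_lt (by omega),
        min_eq_right (by omega), Nat.sub_sub_self (by omega)]
      intro h0
      have := congrArg ZMod.val h0
      rw [ZMod.val_cast_of_lt (by omega), ZMod.val_zero] at this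
      omega
  · rw [tateCorrection_some_of_middle J habv hϖ h1 h2 h3 h4 hα hn h6 hnh h',
      hcm hh x' y' h' hnh, ZMod.val_cast_of_lt (by omega), min_eq_left (by omega)]

/-- **The `B₂`-formula for Tate's `λ` on the Tate normal form** (Silverman, *ATAEC*,
Thm. VI.4.2(b) and Ex. 6.7(b), with Thm. VI.4.1 on `E₀`): for `J : y² + xy = x³ + απⁿ` over a
discrete valuation ring `R` (`α ∈ Rˣ`, `π` a uniformiser, `n ≥ 1`), a nonarchimedean absolute
value `|·|` on `K = Frac R` with unit ball `R`, and a component homomorphism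
`c : J(K) →+ ℤ/nℤ` as in `LocalIndex.exists_addMonoidHom_zmod_of_tateNormalForm`, Tate's
series evaluates, for **every** `P ∈ J(K)` (also `P = O` with its junk value), to
`λ(P) = ½log⁺|x(P)| + ½𝐁₂(c(P)/n) · n v(π)`, `v(π) = −log|π|`, `n v(π) = v(Δ)`,
`𝐁₂ = periodizedBernoulli 2`, `c(P)/n ∈ ℝ/ℤ` via `ZMod.toAddCircle`.
[cite: Silverman1994, Thm VI.4.2(b)] -/
theorem neronLocalHeight_eq_of_tateNormalForm [NeZero n] (hϖ : Irreducible ϖ) (h1 : J.a₁ = 1)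
    (h2 : J.a₂ = 0) (h3 : J.a₃ = 0) (h4 : J.a₄ = 0) (hα : IsUnit α) (hn : 1 ≤ n)
    (h6 : J.a₆ = α * ϖ ^ n) (hna : IsNonarchimedean abv)
    {c : (J.baseChange K).toAffine.Point →+ ZMod n}
    (hc0 : ∀ P, c P = 0 ↔ J.HasNonsingularReduction P)
    (hcl : ∀ (i : ℕ) (u t : R) (h : (J.baseChange K).toAffine.Nonsingular
        (algebraMap R K (ϖ ^ i * u)) (algebraMap R K (ϖ ^ i * u * t))),
      1 ≤ i → 2 * i < n → IsUnit u → t ∈ maximalIdeal R → c (.some _ _ h) = (i : ZMod n))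
    (hcl' : ∀ (i : ℕ) (u t : R) (h : (J.baseChange K).toAffine.Nonsingular
        (algebraMap R K (ϖ ^ i * u)) (algebraMap R K (ϖ ^ i * u * t))),
      1 ≤ i → 2 * i < n → IsUnit u → t + 1 ∈ maximalIdeal R → c (.some _ _ h) = -(i : ZMod n))
    (hcm : ∀ (hh : ℕ) (x' y' : R) (h : (J.baseChange K).toAffine.Nonsingular
        (algebraMap R K (ϖ ^ hh * x')) (algebraMap R K (ϖ ^ hh * y'))),
      n = 2 * hh → c (.some _ _ h) = (hh : ZMod n))
    (P : (J.baseChange K).toAffine.Point) :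
    neronLocalHeight abv P = naiveLocalHeight abv P +
      1 / 2 * periodizedBernoulli 2 (ZMod.toAddCircle (c P)) *
        (n * (-Real.log (abv (algebraMap R K ϖ)))) := by
  set L : ℝ := -Real.log (abv (algebraMap R K ϖ)) with hL
  set ℓ : ZMod n → ℝ := fun m => ((min m.val (n - m.val) : ℕ) : ℝ) with hℓ
  have hn0 : (0 : ℝ) < n := by exact_mod_cast Nat.pos_of_ne_zero (NeZero.ne n)
  -- termwise evaluation of Tate's series
  have hterm : ∀ k : ℕ, (1 / 4 : ℝ) ^ (k + 1) * tateCorrection abv ((2 ^ k) • P) =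
      (n : ℝ) / 4 * L * (1 / 4 : ℝ) ^ (k + 1) - L * ((1 / 4 : ℝ) ^ (k + 1) * ℓ (2 ^ k • c P)) := by
    intro k
    rw [tateCorrection_eq_of_component J habv hϖ h1 h2 h3 h4 hα hn h6 hna hc0 hcl hcl' hcm,
      map_nsmul, hℓ]
    ring
  have hgeom : Summable fun k : ℕ => (n : ℝ) / 4 * L * (1 / 4 : ℝ) ^ (k + 1) :=
    ((summable_geometric_of_lt_one (by norm_num) (by norm_num : (1 / 4 : ℝ) < 1)).mul_left
      ((n : ℝ) / 4 * L * (1 / 4))).congr fun k => by ring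
  have hgeom' : ∑' k : ℕ, (n : ℝ) / 4 * L * (1 / 4 : ℝ) ^ (k + 1) = (n : ℝ) / 12 * L := by
    have : (fun k : ℕ => (n : ℝ) / 4 * L * (1 / 4 : ℝ) ^ (k + 1)) =
        fun k : ℕ => (n : ℝ) / 4 * L * (1 / 4) * (1 / 4 : ℝ) ^ k := funext fun k => by ring
    rw [this, tsum_mul_left, tsum_geometric_of_lt_one (by norm_num) (by norm_num)]
    ring
  have hℓ0 : ∀ m, 0 ≤ ℓ m := fun m => Nat.cast_nonneg _
  have hℓn : ∀ m, ℓ m ≤ n := fun m => by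
    show ((min m.val (n - m.val) : ℕ) : ℝ) ≤ n
    exact_mod_cast (min_le_left _ _).trans (ZMod.val_lt m).le
  have hlev : Summable fun k : ℕ => (1 / 4 : ℝ) ^ (k + 1) * ℓ (2 ^ k • c P) := by
    have hg : Summable fun k : ℕ => (1 / 4 : ℝ) ^ (k + 1) * n :=
      ((summable_geometric_of_lt_one (by norm_num) (by norm_num : (1 / 4 : ℝ) < 1)).mul_left
        (1 / 4 * (n : ℝ))).congr fun k => by ring
    exact Summable.of_nonneg_of_le (fun k => mul_nonneg (by positivity) (hℓ0 _))
      (fun k => mul_le_mul_of_nonneg_left (hℓn _) (by positivity)) hg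
  have hμ : tateMu abv P = (n : ℝ) / 12 * L - L * ((c P).val * ((n : ℝ) - (c P).val) / (2 * n)) := by
    unfold tateMu
    rw [tsum_congr hterm, (hgeom.tsum_sub (hlev.mul_left L)), hgeom', tsum_mul_left,
      tsum_level_two_pow_nsmul]
  -- the periodic Bernoulli function at `c P / n`
  have hB : periodizedBernoulli 2 (ZMod.toAddCircle (c P)) =
      ((c P).val / n : ℝ) ^ 2 - (c P).val / n + 1 / 6 := by
    rw [ZMod.toAddCircle_apply]
    exact periodizedBernoulli_two_coe (by positivity)
      ((div_lt_one hn0).mpr (by exact_mod_cast ZMod.val_lt (c P)))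
  rw [neronLocalHeight, hμ, hB]
  field_simp
  ring

/-- **The local inequality at a split multiplicative place, on the Tate normal form**:
`λ(P) ≥ ½𝐁₂(c(P)/n) · n v(π)` for every `P ∈ J(K)` (since `log⁺ ≥ 0`); the inequality
*"`λ̂(P; v) ≥ ½𝐁(a_v(P)/n_v) log N𝔭_v^{n_v}`"* of Silverman, arXiv:0908.3895, proof of Thm. 5.
[cite: Silverman1994, Thm VI.4.2(b)] -/
theorem le_neronLocalHeight_of_tateNormalForm [NeZero n] (hϖ : Irreducible ϖ) (h1 : J.a₁ = 1)
    (h2 : J.a₂ = 0) (h3 : J.a₃ = 0) (h4 : J.a₄ = 0) (hα : IsUnit α) (hn : 1 ≤ n)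
    (h6 : J.a₆ = α * ϖ ^ n) (hna : IsNonarchimedean abv)
    {c : (J.baseChange K).toAffine.Point →+ ZMod n}
    (hc0 : ∀ P, c P = 0 ↔ J.HasNonsingularReduction P)
    (hcl : ∀ (i : ℕ) (u t : R) (h : (J.baseChange K).toAffine.Nonsingular
        (algebraMap R K (ϖ ^ i * u)) (algebraMap R K (ϖ ^ i * u * t))),
      1 ≤ i → 2 * i < n → IsUnit u → t ∈ maximalIdeal R → c (.some _ _ h) = (i : ZMod n))
    (hcl' : ∀ (i : ℕ) (u t : R) (h : (J.baseChange K).toAffine.Nonsingular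
        (algebraMap R K (ϖ ^ i * u)) (algebraMap R K (ϖ ^ i * u * t))),
      1 ≤ i → 2 * i < n → IsUnit u → t + 1 ∈ maximalIdeal R → c (.some _ _ h) = -(i : ZMod n))
    (hcm : ∀ (hh : ℕ) (x' y' : R) (h : (J.baseChange K).toAffine.Nonsingular
        (algebraMap R K (ϖ ^ hh * x')) (algebraMap R K (ϖ ^ hh * y'))),
      n = 2 * hh → c (.some _ _ h) = (hh : ZMod n))
    (P : (J.baseChange K).toAffine.Point) :
    1 / 2 * periodizedBernoulli 2 (ZMod.toAddCircle (c P)) *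
        (n * (-Real.log (abv (algebraMap R K ϖ)))) ≤ neronLocalHeight abv P := by
  rw [neronLocalHeight_eq_of_tateNormalForm J habv hϖ h1 h2 h3 h4 hα hn h6 hna hc0 hcl hcl' hcm P]
  have := naiveLocalHeight_nonneg abv P
  linarith

end AbsValue

end TateNormalForm

end LocalIndex

end Literature.NumberTheory.EllipticCurves

end
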